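import Summits.RiemannHypothesis.RiemannHypothesis.Theorems.ZetaStringArchFormIdentity
import Summits.RiemannHypothesis.RiemannHypothesis.Theorems.ZetaStringKreinFormComb
import Summits.RiemannHypothesis.RiemannHypothesis.Theorems.ZetaStringArchWallHolds
import Summits.RiemannHypothesis.RiemannHypothesis.Theorems.SemilocalCertEmpty03674Threshold
import Summits.RiemannHypothesis.RiemannHypothesis.Theorems.PluckedStringScrewToWeilOn
import Literature.Analysis.Matrix.PosDefKernelDoubleIntegral
import Mathlib.Analysis.Complex.ExponentialBounds
import HarnessLib

/-!
# The WEIL ↔ DBR dictionary in the kernel: `ArchWallHolds ℓ ↔ ℓ/2 ≤ a*(∅)`; the wall bracket `[1505/2048, 0.7434]` (RH-FREE)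

LINE 1 — LABEL: RH-FREE. Every statement is a finite/structural fact about the archimedean (prime-free) parts of the
explicit formula — Column WEIL's semi-local threshold `a*(∅) = weilSemilocalThreshold ∅` and Column DBR's wall kernel
`archKernel` — or glue between them; the positivity radius of the wall says nothing about the zeros of `ζ`; nothing here
bears on the truth of RH. bears_on: LADDER-RH B-D → B-P(P1) (cell rh-dbr ET6 row `N = 2`, TARGET-v7 §K.2
`ArchWallHolds 0.74` / `ArchWallBracket`; cross-column STEP-0 note XCOL-ET6-vs-WEIL-SEMILOCAL, rh-dbr-eng-6 g4,
2026-08-26, §4.6). WHAT THIS IS NOT: not progress toward RH; not a new certificate (the two numerical ends are Column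
WEIL's kernel theorems `weilSemilocalPositivityOn_empty_03674` and `weilSemilocalThreshold_empty_le_03717`, re-indexed).

**Theorem (the dictionary).** For every real `a`,
`IsPosSemidefKernelOn archKernel (Ioo (−a) a) ↔ WeilSemilocalPositivityOn ∅ a` (`isPosSemidefKernelOn_archKernel_iff`);
hence for every `ℓ`, `ArchWallHolds ℓ ↔ WeilSemilocalPositivityOn ∅ (ℓ/2) ↔ ℓ ≤ 2·a*(∅)` and
`ArchWallTies ℓ ↔ 2·a*(∅) < ℓ`: **the DBR wall radius `ℓ*(∅)` IS `2·weilSemilocalThreshold ∅`.**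

* (⟸, `isPosSemidefKernelOn_archKernel_of_weilSemilocalPositivityOn`) the identity `Q_∅(ψ) = ⟨ψ′,ψ′⟩_{G_∅,a}`
  (`weilSemilocalQuadratic_empty_eq_archForm`, sibling `ZetaStringArchFormIdentity`) on primitives of mollified combs and
  the generic comb theorem `KreinFormComb.krein_psd_Ioo_of_forall_re_nonneg`;
* (⟹, `weilSemilocalPositivityOn_empty_of_isPosSemidefKernelOn`) the same identity, the re/im split of `ψ′`, integrated
  positivity of a continuous finitely-PSD kernel on the compact window `[−b, b]`, `b < a`
  (`Literature.Analysis.Matrix.IsPosDefKernel.integral_integral_nonneg_of_isFiniteMeasure`), and CLOSEDNESS of the set of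
  semi-locally positive windows (`MotivicDoor.Semilocal.weilSemilocalPositivityOn_of_forall_lt`, Column WEIL).

**Corollaries (instances of record).** `archWallHolds_1505_2048 : ArchWallHolds (1505/2048)` (`= 0.73486… > log 2`,
supersedes `archWallHolds_log_two`); `archWallTies_of_gt : 3717/5000 < ℓ → ArchWallTies ℓ` (`0.7434 < 3/4`, supersedes
`archWallTies_three_quarters` away from the endpoint); the tree bracket for the wall radius becomes
`1505/2048 ≤ ℓ*(∅) = 2a*(∅) ≤ 3717/5000` (ET6 numerics of record `0.74320`; Column WEIL DATA `2 × 0.37160`). TARGET-v7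
§K.2's typed `ArchWallHolds 0.74` is EQUIVALENT to `37/100 ≤ a*(∅)` (`archWallHolds_074_iff`) and stays OPEN in both
columns (kernel `0.367432 < 0.37 ≤` certified `0.3713`).

References: M. Suzuki, J. Lond. Math. Soc. (2) 108 (2023) = arXiv:2206.03682, (1.4)–(1.5), Prop. 3.1; H. Yoshida, Adv.
Stud. Pure Math. 21 (1992) Thm 1, Prop. 6; A. Connes, Selecta Math. 5 (1999) §VII Thm 4; C. Berg, J. P. R. Christensen,
P. Ressel, *Harmonic Analysis on Semigroups* (1984) Ch. 3 §1, Ch. 4 §1.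
-/

-- `Summit.RiemannHypothesis.RiemannHypothesis.…` duplicates `RiemannHypothesis` BY DESIGN (D-0017).
set_option linter.dupNamespace false

noncomputable section

open MeasureTheory Set Filter Complex
open scoped ComplexConjugate BigOperators

namespace Summit.RiemannHypothesis.RiemannHypothesis.Theorems.ZetaStringArchWall

open Literature.NumberTheory.LFunctions Literature.Analysis.Complex Literature.Analysis.Matrix
open Summit.RiemannHypothesis.RiemannHypothesis.Theorems.KreinFormComb
open Summit.RiemannHypothesis.RiemannHypothesis.Theorems.MotivicDoor.SemilocalThreshold
open Summit.RiemannHypothesis.RiemannHypothesis.Theorems.MotivicDoor.Semilocal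
  (weilSemilocalPositivityOn_of_forall_lt)
open Summit.RiemannHypothesis.RiemannHypothesis.Theorems.SemilocalCertEmpty
  (weilSemilocalPositivityOn_empty_03674 le_weilSemilocalThreshold_empty_03674)
open Summit.RiemannHypothesis.RiemannHypothesis.Theorems.SemilocalPolyWitness
  (weilSemilocalThreshold_empty_le_03717)

variable {a : ℝ}

/-! ## §1 The wall `Ψ_∅` as a real kernel -/

/-- `Ψ_∅` is continuous. [folklore] -/
theorem continuous_archScrew : Continuous archScrew := by
  show Continuous fun t => zetaScrew t + zetaScrewPrimeSum t
  exact continuous_zetaScrew.add continuous_zetaScrewPrimeSum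

/-- The real wall kernel `Ψ_∅(t) + Ψ_∅(u) − Ψ_∅(t−u)` is jointly continuous. [folklore] -/
theorem continuous_archKernel_real :
    Continuous fun p : ℝ × ℝ => archScrew p.1 + archScrew p.2 - archScrew (p.1 - p.2) :=
  continuous_kreinKernel_real continuous_archScrew

/-- `archKernel` is the complexification of the real wall kernel. [folklore] -/
theorem archKernel_eq_ofReal (t u : ℝ) :
    archKernel t u = ((archScrew t + archScrew u - archScrew (t - u) : ℝ) : ℂ) := rfl

/-! ## §2 Semi-local positivity at `S = ∅` ⟹ the wall kernel is PSD on the open window -/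

/-- **WEIL ⟹ DBR.** If the semi-local Weil form at `S = ∅` is non-negative on `C(a)`, then the wall kernel
`G_∅ = Ψ_∅(t) + Ψ_∅(u) − Ψ_∅(t−u)` is positive semidefinite on finite configurations in the OPEN window `(−a, a)`.
(For `φ ∈ 𝔈₀(a)`: `0 ≤ Re Q_∅(I₀φ) = Re ⟨φ, φ⟩_{G_∅,a}` by `weilSemilocalQuadratic_empty_eq_archForm`; then mollified combs.)
[cite: Suzuki2023, (1.5) and Prop 3.1] -/
theorem isPosSemidefKernelOn_archKernel_of_weilSemilocalPositivityOn (hW : WeilSemilocalPositivityOn ∅ a) :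
    IsPosSemidefKernelOn archKernel (Ioo (-a) a) := by
  by_cases ha : 0 < a
  swap
  · intro N t ht c
    rcases Nat.eq_zero_or_pos N with hN | hN
    · subst hN; simp
    · exact absurd (ht ⟨0, hN⟩) fun h => ha (by linarith [h.1, h.2])
  rw [← kreinKernel_archScrew]
  refine krein_psd_Ioo_of_forall_re_nonneg continuous_archScrew archScrew_neg archScrew_zero fun φ hφ => ?_
  have hψ : screwPrimitive a 0 φ ∈ screwTestC a := screwPrimitive_mem_screwTestC hφ
  have h : 0 ≤ (weilSemilocalQuadratic ∅ (screwPrimitive a 0 φ)).re := hW _ hψ.1 hψ.2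
  rw [weilSemilocalQuadratic_empty_eq_archForm ha hψ, deriv_screwPrimitive_of_mem hφ] at h
  rw [kreinKernel_archScrew]
  exact h

/-! ## §3 The wall kernel PSD on the open window ⟹ semi-local positivity at `S = ∅` -/

/-- **Integrated positivity on the compact window** for a real, symmetric, jointly continuous kernel `K` whose real
quadratic forms are non-negative on finite configurations in `[−a, a]`: for every continuous real weight `φ`,
`0 ≤ ∫_{[−a,a]}∫_{[−a,a]} φ(t) φ(u) K(t,u) du dt` (the tree's sampling lemma
`IsPosDefKernel.integral_integral_nonneg_of_isFiniteMeasure` on the compact type `Icc (−a) a`).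
[cite: BergChristensenRessel1984, Ch. 3 Def. 1.1 (PDF p. 68) and Ch. 4 §1] -/
theorem setIntegral_setIntegral_mul_mul_nonneg_of_psd {K : ℝ → ℝ → ℝ} (hK : Continuous fun p : ℝ × ℝ => K p.1 p.2)
    (hKs : ∀ t u, K t u = K u t)
    (hpsd : ∀ (N : ℕ) (t : Fin N → ℝ) (x : Fin N → ℝ), (∀ i, t i ∈ Icc (-a) a) →
      0 ≤ ∑ i, ∑ j, x i * x j * K (t i) (t j))
    {φ : ℝ → ℝ} (hφ : Continuous φ) :
    0 ≤ ∫ t in Icc (-a) a, ∫ u in Icc (-a) a, φ t * φ u * K t u := by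
  haveI := ScrewToWeilOn.isFiniteMeasure_comap_val_Icc a
  have hPD : IsPosDefKernel (fun x y : Icc (-a) a => K x.1 y.1) :=
    ⟨fun x y => hKs _ _, fun n x c => hpsd n (fun j => (x j).1) c (fun j => (x j).2)⟩
  have hKc : Continuous fun p : Icc (-a) a × Icc (-a) a => K p.1.1 p.2.1 :=
    hK.comp ((continuous_subtype_val.comp continuous_fst).prodMk (continuous_subtype_val.comp continuous_snd))
  have hφ' : Continuous fun x : Icc (-a) a => φ x.1 := hφ.comp continuous_subtype_val
  have h := hPD.integral_integral_nonneg_of_isFiniteMeasure hKc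
    (Measure.comap Subtype.val volume : Measure (Icc (-a) a)) hφ'
  have hin : ∀ x : Icc (-a) a,
      ∫ y : Icc (-a) a, φ x.1 * φ y.1 * K x.1 y.1 ∂(Measure.comap Subtype.val volume) =
        ∫ u in Icc (-a) a, φ x.1 * φ u * K x.1 u := fun x =>
    integral_subtype_comap measurableSet_Icc (fun u => φ x.1 * φ u * K x.1 u)
  simp_rw [hin] at h
  rwa [integral_subtype_comap measurableSet_Icc (fun t => ∫ u in Icc (-a) a, φ t * φ u * K t u)] at h

/-- **Real part of the hermitian form of a real kernel on the compact window**: for continuous `φ : ℝ → ℂ`,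
`Re ∫∫ K(t,u) φ(u) conj φ(t) = ∫∫ φᵣ(t)φᵣ(u)K(t,u) + ∫∫ φᵢ(t)φᵢ(u)K(t,u)` (`φ = φᵣ + iφᵢ`). [folklore] -/
theorem re_setIntegral_setIntegral_ofReal_Icc {K : ℝ → ℝ → ℝ} (hK : Continuous fun p : ℝ × ℝ => K p.1 p.2)
    (a : ℝ) {φ : ℝ → ℂ} (hφc : Continuous φ) :
    (∫ t in Icc (-a) a, ∫ u in Icc (-a) a, ((K t u : ℝ) : ℂ) * φ u * conj (φ t)).re =
      (∫ t in Icc (-a) a, ∫ u in Icc (-a) a, (φ t).re * (φ u).re * K t u) +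
        ∫ t in Icc (-a) a, ∫ u in Icc (-a) a, (φ t).im * (φ u).im * K t u := by
  have hφrc : Continuous fun u => (φ u).re := continuous_re.comp hφc
  have hφic : Continuous fun u => (φ u).im := continuous_im.comp hφc
  have hfc : Continuous (Function.uncurry fun t u : ℝ => ((K t u : ℝ) : ℂ) * φ u * conj (φ t)) :=
    ((continuous_ofReal.comp hK).mul (hφc.comp continuous_snd)).mul
      ((continuous_conj.comp hφc).comp continuous_fst)
  have hAc : Continuous (Function.uncurry fun t u : ℝ => (φ t).re * (φ u).re * K t u) :=
    ((hφrc.comp continuous_fst).mul (hφrc.comp continuous_snd)).mul hK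
  have hBc : Continuous (Function.uncurry fun t u : ℝ => (φ t).im * (φ u).im * K t u) :=
    ((hφic.comp continuous_fst).mul (hφic.comp continuous_snd)).mul hK
  have hf_re : ∀ t u : ℝ, (((K t u : ℝ) : ℂ) * φ u * conj (φ t)).re =
      (φ t).re * (φ u).re * K t u + (φ t).im * (φ u).im * K t u := by
    intro t u
    simp only [Complex.mul_re, Complex.mul_im, Complex.ofReal_re, Complex.ofReal_im,
      Complex.conj_re, Complex.conj_im]
    ring
  have hre_in : ∀ t, (∫ u in Icc (-a) a, ((K t u : ℝ) : ℂ) * φ u * conj (φ t)).re =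
      (∫ u in Icc (-a) a, (φ t).re * (φ u).re * K t u) +
        ∫ u in Icc (-a) a, (φ t).im * (φ u).im * K t u := by
    intro t
    have h1 := integral_re ((hfc.uncurry_left t).integrableOn_Icc (a := -a) (b := a) (μ := volume))
    simp only [RCLike.re_to_complex] at h1
    rw [← h1]
    simp_rw [hf_re]
    exact integral_add ((hAc.uncurry_left t).integrableOn_Icc) ((hBc.uncurry_left t).integrableOn_Icc)
  have hFi : IntegrableOn (fun t => ∫ u in Icc (-a) a, ((K t u : ℝ) : ℂ) * φ u * conj (φ t)) (Icc (-a) a) :=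
    (continuous_parametric_integral_of_continuous hfc isCompact_Icc).integrableOn_Icc
  have h2 := integral_re hFi
  simp only [RCLike.re_to_complex] at h2
  rw [← h2]
  simp_rw [hre_in]
  exact integral_add
    (continuous_parametric_integral_of_continuous hAc isCompact_Icc).integrableOn_Icc
    (continuous_parametric_integral_of_continuous hBc isCompact_Icc).integrableOn_Icc

/-- **Hermitian positivity from kernel positivity**: if the real symmetric continuous kernel `K` is PSD on finite
configurations in `[−a, a]`, then `Re ∫_{(−a,a)}∫_{(−a,a)} K(t,u) φ(u) conj φ(t) du dt ≥ 0` for every continuous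
`φ : ℝ → ℂ`. [cite: BergChristensenRessel1984, Ch. 4 §1] -/
theorem re_setIntegral_setIntegral_nonneg_of_psd {K : ℝ → ℝ → ℝ} (hK : Continuous fun p : ℝ × ℝ => K p.1 p.2)
    (hKs : ∀ t u, K t u = K u t)
    (hpsd : ∀ (N : ℕ) (t : Fin N → ℝ) (x : Fin N → ℝ), (∀ i, t i ∈ Icc (-a) a) →
      0 ≤ ∑ i, ∑ j, x i * x j * K (t i) (t j))
    {φ : ℝ → ℂ} (hφc : Continuous φ) :
    0 ≤ (∫ t in Ioo (-a) a, ∫ u in Ioo (-a) a, ((K t u : ℝ) : ℂ) * φ u * conj (φ t)).re := by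
  have hS : (∫ t in Ioo (-a) a, ∫ u in Ioo (-a) a, ((K t u : ℝ) : ℂ) * φ u * conj (φ t)) =
      ∫ t in Icc (-a) a, ∫ u in Icc (-a) a, ((K t u : ℝ) : ℂ) * φ u * conj (φ t) := by
    rw [setIntegral_congr_set Ioo_ae_eq_Icc]
    refine setIntegral_congr_fun measurableSet_Icc fun t _ => ?_
    exact setIntegral_congr_set Ioo_ae_eq_Icc
  rw [hS, re_setIntegral_setIntegral_ofReal_Icc hK a hφc]
  exact add_nonneg (setIntegral_setIntegral_mul_mul_nonneg_of_psd hK hKs hpsd (continuous_re.comp hφc))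
    (setIntegral_setIntegral_mul_mul_nonneg_of_psd hK hKs hpsd (continuous_im.comp hφc))

/-- **DBR ⟹ WEIL on the compact window.** If the wall kernel is PSD on finite configurations in the COMPACT window
`[−a, a]` (`0 < a`), then the semi-local Weil form at `S = ∅` is non-negative on `C(a)`. [cite: Suzuki2023, Prop 3.1 and (1.4)] -/
theorem weilSemilocalPositivityOn_empty_of_isPosSemidefKernelOn_Icc (ha : 0 < a)
    (h : IsPosSemidefKernelOn archKernel (Icc (-a) a)) : WeilSemilocalPositivityOn ∅ a := by
  intro g hg hsupp
  have hψ : g ∈ screwTestC a := ⟨hg, hsupp⟩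
  have hφc : Continuous (deriv g) := hg.1.continuous_deriv (by simp)
  rw [re_weilSemilocalQuadratic_empty_eq_archForm ha hψ]
  have hpsd : ∀ (N : ℕ) (t : Fin N → ℝ) (x : Fin N → ℝ), (∀ i, t i ∈ Icc (-a) a) →
      0 ≤ ∑ i, ∑ j, x i * x j * (archScrew (t i) + archScrew (t j) - archScrew (t i - t j)) := by
    intro N t x ht
    rw [← kreinKernel_archScrew, krein_psd_iff_real archScrew_neg] at h
    refine (h N t x ht).trans_eq (Finset.sum_congr rfl fun i _ => Finset.sum_congr rfl fun j _ => ?_)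
    ring
  have hKs : ∀ t u : ℝ, archScrew t + archScrew u - archScrew (t - u) =
      archScrew u + archScrew t - archScrew (u - t) := by
    intro t u; rw [← archScrew_neg (t - u), neg_sub]; ring
  simp only [archKernel_eq_ofReal]
  exact re_setIntegral_setIntegral_nonneg_of_psd (K := fun t u => archScrew t + archScrew u - archScrew (t - u))
    continuous_archKernel_real hKs hpsd hφc

/-- **DBR ⟹ WEIL.** If the wall kernel is PSD on finite configurations in the OPEN window `(−a, a)`, then the
semi-local Weil form at `S = ∅` is non-negative on `C(a)`: every smaller compact window `[−b, b]`, `b < a`, lies in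
`(−a, a)`, and the set of semi-locally positive windows is CLOSED (Column WEIL's
`weilSemilocalPositivityOn_of_forall_lt`). Degenerate windows `a ≤ 0` hold unconditionally. [cite: Yoshida1992HermitianForms, Prop. 6 (p. 320) with Lemma 7 (p. 312)] -/
theorem weilSemilocalPositivityOn_empty_of_isPosSemidefKernelOn (h : IsPosSemidefKernelOn archKernel (Ioo (-a) a)) :
    WeilSemilocalPositivityOn ∅ a := by
  by_cases ha : 0 < a
  · refine weilSemilocalPositivityOn_of_forall_lt ha fun b hb hba => ?_
    exact weilSemilocalPositivityOn_empty_of_isPosSemidefKernelOn_Icc hb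
      (h.mono (Icc_subset_Ioo (by linarith) hba))
  · exact (weilSemilocalPositivityOn_log_two_half ∅).mono
      ((not_lt.1 ha).trans (div_nonneg (Real.log_nonneg one_le_two) zero_le_two))

/-! ## §4 The dictionary -/

/-- **THE WEIL ↔ DBR DICTIONARY (archimedean row).** For every real `a`: the wall kernel
`Ψ_∅(t) + Ψ_∅(u) − Ψ_∅(t−u)` is positive semidefinite on finite configurations in `(−a, a)` iff the semi-local Weil
form at `S = ∅` is non-negative on `C(a)`. RH-FREE glue; nothing here bears on RH. [cite: Suzuki2023, (1.5) and Prop 3.1] -/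
theorem isPosSemidefKernelOn_archKernel_iff (a : ℝ) :
    IsPosSemidefKernelOn archKernel (Ioo (-a) a) ↔ WeilSemilocalPositivityOn ∅ a :=
  ⟨weilSemilocalPositivityOn_empty_of_isPosSemidefKernelOn,
    isPosSemidefKernelOn_archKernel_of_weilSemilocalPositivityOn⟩

/-- `ArchWallHolds ℓ ↔ WeilSemilocalPositivityOn ∅ (ℓ/2)` (one-sided window `ℓ` ↔ symmetric half-width `ℓ/2`).
[cite: Suzuki2023, (1.5)] -/
theorem archWallHolds_iff_weilSemilocalPositivityOn (l : ℝ) :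
    ArchWallHolds l ↔ WeilSemilocalPositivityOn ∅ (l / 2) := by
  rw [archWallHolds_iff_symm, isPosSemidefKernelOn_archKernel_iff]

/-- **`ArchWallHolds ℓ ↔ ℓ ≤ 2·a*(∅)`**: the DBR wall holds on the one-sided window `(0, ℓ)` iff `ℓ` is at most twice
Column WEIL's archimedean semi-local threshold `weilSemilocalThreshold ∅`. [cite: Yoshida1992HermitianForms, Prop. 6 (p. 320)] -/
theorem archWallHolds_iff_le (l : ℝ) : ArchWallHolds l ↔ l ≤ 2 * weilSemilocalThreshold ∅ := by
  rw [archWallHolds_iff_weilSemilocalPositivityOn, weilSemilocalPositivityOn_iff_le_weilSemilocalThreshold]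
  constructor <;> intro h <;> linarith

/-- **`ArchWallTies ℓ ↔ 2·a*(∅) < ℓ`**: the wall ties inside `(0, ℓ)` iff `ℓ` exceeds twice the archimedean
semi-local threshold. [cite: Yoshida1992HermitianForms, Prop. 6 (p. 320)] -/
theorem archWallTies_iff_lt (l : ℝ) : ArchWallTies l ↔ 2 * weilSemilocalThreshold ∅ < l := by
  unfold ArchWallTies
  rw [← not_le, ← archWallHolds_iff_le]
  rfl

/-- **The DBR wall radius is `2·a*(∅)`**: `ArchWallHolds (2·a*(∅))` and `ArchWallTies ℓ` for every larger `ℓ` — the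
supremum of the one-sided windows on which the wall holds is attained and equals `2 · weilSemilocalThreshold ∅`
(ET6 numerics of record: `ℓ*(∅) = 0.74320`; Column WEIL DATA `a*(∅) = 0.37160`). [cite: Yoshida1992HermitianForms, Prop. 6 (p. 320)] -/
theorem archWallHolds_two_mul_weilSemilocalThreshold :
    ArchWallHolds (2 * weilSemilocalThreshold ∅) ∧ ∀ l, 2 * weilSemilocalThreshold ∅ < l → ArchWallTies l :=
  ⟨(archWallHolds_iff_le _).2 le_rfl, fun l hl => (archWallTies_iff_lt l).2 hl⟩

/-! ## §5 Instances of record: Column WEIL's kernel theorems, re-indexed -/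

/-- **`ArchWallHolds (1505/2048)`** (`1505/2048 = 0.73486…`): the archimedean wall is positive semidefinite on every
finite configuration in `(0, 1505/2048)` — Column WEIL's kernel-checked archimedean certificate
`weilSemilocalPositivityOn_empty_03674 : WeilSemilocalPositivityOn ∅ (1505/4096)` through the dictionary. Supersedes
`archWallHolds_log_two` (`log 2 = 0.6931…`). RH-FREE; nothing here bears on RH. [cite: Yoshida1992, Thm 1 (p. 310), §6 (certificate method)] -/
theorem archWallHolds_1505_2048 : ArchWallHolds (1505 / 2048) := by
  rw [archWallHolds_iff_weilSemilocalPositivityOn]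
  convert weilSemilocalPositivityOn_empty_03674 using 1
  norm_num

/-- `log 2 < 1505/2048`: the new positive window strictly contains the prime-free one. [folklore] -/
theorem log_two_lt_1505_2048 : Real.log 2 < 1505 / 2048 := by
  have := Real.log_two_lt_d9; norm_num at this ⊢; linarith

/-- **`ArchWallTies ℓ` for every `ℓ > 3717/5000 = 0.7434`**: Column WEIL's kernel-checked negative certificate
`weilSemilocalThreshold_empty_le_03717 : a*(∅) ≤ 0.3717` through the dictionary. Sharpens `archWallTies_three_quarters`
away from the endpoint (`0.7434 < 0.75`). RH-FREE; nothing here bears on RH. [cite: Yoshida1992HermitianForms, Prop. 6 (p. 320)] -/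
theorem archWallTies_of_gt {l : ℝ} (hl : 3717 / 5000 < l) : ArchWallTies l := by
  rw [archWallTies_iff_lt]
  have h := weilSemilocalThreshold_empty_le_03717
  have e : (((3717 / 10000 : ℚ) : ℝ)) = 3717 / 10000 := by push_cast; ring
  rw [e] at h
  linarith

/-- **The tree bracket for the wall radius (ET6 row `N = 2`)**: `1505/2048 ≤ 2·a*(∅) ≤ 3717/5000`, i.e.
`0.73486 ≤ ℓ*(∅) ≤ 0.7434` (was `[log 2, 3/4] = [0.6931, 0.75]`; ET6 numerics `0.74320`). RH-FREE finite facts about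
`Ψ_∅`; nothing here bears on RH. [cite: Yoshida1992HermitianForms, Prop. 6 (p. 320)] -/
theorem two_mul_weilSemilocalThreshold_empty_mem_Icc :
    2 * weilSemilocalThreshold ∅ ∈ Icc ((1505 : ℝ) / 2048) (3717 / 5000) := by
  have h1 := le_weilSemilocalThreshold_empty_03674
  have h2 := weilSemilocalThreshold_empty_le_03717
  have e : (((3717 / 10000 : ℚ) : ℝ)) = 3717 / 10000 := by push_cast; ring
  rw [e] at h2
  constructor <;> linarith

/-- The sharpened bracket in `ArchWallHolds`/`ArchWallTies` form: holds on `(0, 1505/2048)`, ties inside `(0, 3/4)`.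
[cite: Yoshida1992HermitianForms, Prop. 6 (p. 320)] -/
theorem archWall_bracket_1505_2048 : ArchWallHolds (1505 / 2048) ∧ ArchWallTies (3 / 4) :=
  ⟨archWallHolds_1505_2048, archWallTies_of_gt (by norm_num)⟩

/-- **TARGET-v7 §K.2 reduced to Column WEIL**: the typed DBR target `ArchWallHolds 0.74` is EQUIVALENT to
`37/100 ≤ a*(∅)` — OPEN in both columns (kernel lower end `1505/4096 = 0.3674 < 0.37`; certified computation `0.3713`;
DATA `0.37160`). [cite: Yoshida1992HermitianForms, Prop. 6 (p. 320)] -/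
theorem archWallHolds_074_iff : ArchWallHolds (0.74 : ℝ) ↔ (37 : ℝ) / 100 ≤ weilSemilocalThreshold ∅ := by
  rw [archWallHolds_iff_le]
  constructor <;> intro h <;> linarith

/-- `ArchWallBracket ↔ 37/100 ≤ a*(∅)` (its `ArchWallTies (3/4)` half is a theorem). [cite: Yoshida1992HermitianForms, Prop. 6 (p. 320)] -/
theorem archWallBracket_iff : ArchWallBracket ↔ (37 : ℝ) / 100 ≤ weilSemilocalThreshold ∅ := by
  unfold ArchWallBracket
  rw [← archWallHolds_074_iff]
  exact ⟨fun h => h.1, fun h => ⟨h, archWallTies_of_gt (by norm_num)⟩⟩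

end Summit.RiemannHypothesis.RiemannHypothesis.Theorems.ZetaStringArchWall

end
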